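import Summits.ResolutionOfSingularities.ResolutionOfSingularities.Theses.AbhyankarShadows
import Summits.ResolutionOfSingularities.ResolutionOfSingularities.Theses.IndSmooth
import Summits.ResolutionOfSingularities.ResolutionOfSingularities.Theorems.FrobeniusClosingPatchingRelPerfectOfAtomDimFour
import Literature.AlgebraicGeometry.Resolution.ResolutionOfComponents
import HarnessLib

/-!
# Crux `PatchingPerfect` (stmt-ResolutionOfSingularities-16089), line `birth` v4:
# the crux CLOSED MODULO the dimension-4 atom of the sibling crux `PatchingRelPerfect`
# (FIBREWISE certificate — one perfect ground field throughout)

Shared crux (rank 4) of routes `ResolutionOfSingularities/AbhyankarShadows` and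
`ResolutionOfSingularities/IndSmooth` (verbatim the same `def`):
`PatchingPerfect` = "for every prime `p` and every PERFECT field `k` of characteristic `p`:
relative local uniformization over `k` implies weak resolution of every reduced separated
`k`-scheme of finite type" — Zariski's patching programme over ONE perfect field. It is the
FIBREWISE form of the sibling crux `FrobeniusClosing.PatchingRelPerfect`
(stmt-ResolutionOfSingularities-16161: LU over ALL perfect fields of characteristic `p` ⇒
resolution over all of them), hence formally stronger (`patchingRelPerfect_of_patchingPerfect`).

The sibling's line `closed-point-slice` LANDED a complete engine
(`Theorems/FrobeniusClosingPatchingRelPerfect*.lean`): LU ⇒ finite resolving system ⇒ iterated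
join with regular roofs at every point ⇒ Temkin's localization induction, fed at non-closed bad
points by the printed dimension-`≤ 3` theorems on a generic fibre and at closed bad points by a
punctual ATOM over complete regular local bases with perfect residue field, algebraized. That
engine consumes LU only over the ground field of the variety being resolved
(`PatchingRelPerfect.SliceOfEngine.hasResolution_projective_of_dim_le_four` takes LU at `k` in the
fibrewise shape), so it serves THIS crux verbatim. This file records it:

* `patchingPerfect_hasResolution_dimLeFour_of_printed_of_atomDimFour` — **for ONE perfect field
  `k` of characteristic `p`: relative LU over `k` + the printed dimension-`≤ 3` theorems
  (Cossart–Piltant 2019 Thm. 1.1 and Prop. 4.4, Cossart–Jannsen–Saito 2020 Thm. 1.2 in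
  single-blow-up format) + the dimension-EXACTLY-4 atom ⇒ every integral separated `k`-scheme
  of finite type of dimension `≤ 4` has a resolution.**
* `patchingPerfect_of_printed_of_atomDimFour_of_dimGeFiveAt` — **the crux BY NAME from the
  printed inputs, the dimension-4 atom (the registered `stub_atomDimFour` of stmt-16161, shared
  verbatim) and the FIBREWISE dimension-`≥ 5` residual** (`RelLU_k ⇒` resolution of integral
  `k`-schemes of dimension `≥ 5`, one perfect `k` at a time). CONDITIONAL; the item stays open.
  `indSmooth_patchingPerfect_of_printed_of_atomDimFour_of_dimGeFiveAt` is the same term for the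
  `IndSmooth` copy.
* `patchingRelPerfect_of_patchingPerfect` — the fibrewise crux implies the uniform sibling crux
  `FrobeniusClosing.PatchingRelPerfect` (so a proof of stmt-16089 closes stmt-16161 as well).

So, after this file, the open content of `PatchingPerfect` is: the dimension-4 atom (local
resolution, in blow-up format, of integral schemes proper and birational over `κ[[x₁,…,x₄]]`,
`κ` perfect of characteristic `p`, regular off the closed fibre — "Cossart–Piltant one
dimension up", shared with stmt-16161), the fibrewise dimension-`≥ 5` residual (crux-sized), and
the printed dimension-`≤ 3` theorems.

## References

* O. Zariski, Ann. of Math. 45 (1944), Fundamental Theorem p. 539. [Zariski1944]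
* O. Piltant, RACSAM 107 (2013), Prop. 5.1, Cor. 5.7, p. 2. [Piltant2013]
* M. Temkin, Adv. Math. 219 (2008), Prop. 2.3.4, Lemma 2.1.1, Lemma 2.1.4. [Temkin2008]
* V. Cossart, O. Piltant, J. Algebra 529 (2019), Thm. 1.1, Prop. 4.4. [CossartPiltant2019]
* V. Cossart, U. Jannsen, S. Saito, LNM 2270 (2020), Thm. 1.2. [CossartJannsenSaito2020]
-/

-- `Summit.<Summit>.<Sub>.Theorems` with `Sub = Summit` (single-conjunct summit, D-0017)
set_option linter.dupNamespace false

noncomputable section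

open CategoryTheory CategoryTheory.Limits AlgebraicGeometry Literature.AlgebraicGeometry.Resolution

namespace Summit.ResolutionOfSingularities.ResolutionOfSingularities.Theorems

/-- **The dimension-`≤ 4` integral slice of `PatchingPerfect`, FIBREWISE**: for `k` perfect of
characteristic `p`, relative local uniformization over `k` (the crux's antecedent at `k`,
verbatim), the printed dimension-`≤ 3` theorems (Cossart–Piltant 2019 Thm. 1.1
`CossartPiltant2019General` and Prop. 4.4 `CossartPiltant2019Principalization`;
Cossart–Jannsen–Saito 2020 Thm. 1.2 in single-blow-up format) and the dimension-EXACTLY-4 atom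
give a resolution of every integral separated `k`-scheme of finite type of dimension `≤ 4`.
Proof: LU at `k` in the fibrewise shape; reduction to integral closed subschemes of `ℙⁿ_k`
(`ResolutionOverUpToDim.of_projective`); finite resolving system, iterated join with regular
roofs (`PatchingRelPerfect.SliceOfEngine.hasResolution_projective_of_dim_le_four`); the roof
engine (`stub_roofEngine`) fed by `stub_localDesingNonClosed` at non-closed points and by the
algebraized atom (`stub_algebraizeBlowup` over
`punctualCompletePerfect_four_of_printed_of_atomDimFour`) at closed points. A CONDITIONAL
result (printed facts and the atom are hypotheses).
[cite: Piltant2013, Prop. 5.1 and Cor. 5.7] [cite: Temkin2008, Prop. 2.3.4]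
[cite: CossartPiltant2019, Thm. 1.1 and Prop. 4.4] [cite: CossartJannsenSaito2020, Thm. 1.2] -/
theorem patchingPerfect_hasResolution_dimLeFour_of_printed_of_atomDimFour (p : ℕ) (hp : p.Prime)
    (hG : CossartPiltant2019General.{0}) (hP : CossartPiltant2019Principalization.{0})
    (hCJS : ∀ (X : Scheme.{0}) [IsNoetherian X] [IsReduced X], Scheme.IsExcellent X →
      topologicalKrullDim X ≤ 2 → Scheme.AdmitsDesingularization X)
    (hA4 : ∀ (S : Type) [CommRing S] [IsRegularLocalRing S] [CharP S p]
      [IsAdicComplete (IsLocalRing.maximalIdeal S) S]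
      [PerfectField (IsLocalRing.ResidueField S)], ringKrullDim S = (4 : ℕ) →
      ∀ (T : Scheme.{0}) (f : T ⟶ Spec (.of S)), IsIntegral T → IsProper f → IsBirational f →
        (∀ t : T, f.base t ≠ IsLocalRing.closedPoint S → IsRegularLocalRing (T.presheaf.stalk t)) →
        ∃ (J : T.IdealSheafData) (T' : Scheme.{0}) (π : T' ⟶ T), J ≠ ⊥ ∧
          (∀ t : T, t ∈ J.support → f.base t = IsLocalRing.closedPoint S) ∧
          IsBlowup π J ∧ Scheme.IsRegular T')
    (k : Type) [Field k] [CharP k p] [PerfectField k]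
    (hLU : ∀ (K : Type) [Field K] [Algebra k K], (⊤ : IntermediateField k K).FG →
      ∀ O : ValuationSubring K, (∀ c : k, algebraMap k K c ∈ O) → ∀ R : Subalgebra k K, R.FG →
        R.toSubring ≤ O.toSubring → ∃ (A : Subalgebra k K) (h : A.toSubring ≤ O.toSubring),
          R ≤ A ∧ A.FG ∧ IsFractionRing A K ∧ IsRegularLocalRing (Localization.AtPrime
            (Ideal.comap (Subring.inclusion h) (IsLocalRing.maximalIdeal O))))
    (X : Scheme.{0}) (f : X ⟶ Spec (.of k)) [IsSeparated f] [LocallyOfFiniteType f]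
    [QuasiCompact f] [IsIntegral X] (hX : topologicalKrullDim X ≤ 4) :
    Scheme.HasResolution X := by
  have hCP : CossartPiltant2019.{0} := hG.cossartPiltant2019 Stacks07QW_field_holds
  -- (LU) at `k`, in the fibrewise shape the engine consumes
  have hLU' : ∀ (K : Type) [Field K] [Algebra k K] (O : ValuationSubring K) (R : Subalgebra k K),
      R.FG → IsFractionRing R K → R.toSubring ≤ O.toSubring →
        ∃ (A : Subalgebra k K) (h : A.toSubring ≤ O.toSubring), R ≤ A ∧ A.FG ∧
          IsRegularLocalRing (Localization.AtPrime
            (Ideal.comap (Subring.inclusion h) (IsLocalRing.maximalIdeal O))) := by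
    intro K _ _ O R hRfg hRfr hRO
    haveI : Algebra.FiniteType k R := R.fg_iff_finiteType.mp hRfg
    haveI : Algebra.EssFiniteType R K :=
      Algebra.EssFiniteType.of_isLocalization K (nonZeroDivisors R)
    have hKfg : (⊤ : IntermediateField k K).FG :=
      IntermediateField.fg_top_iff.mpr (Algebra.EssFiniteType.comp k R K)
    obtain ⟨A, h, hle, hAfg, -, hreg⟩ :=
      hLU K hKfg O (fun c => hRO (R.algebraMap_mem c)) R hRfg hRO
    exact ⟨A, h, hle, hAfg, hreg⟩
  -- the punctual atom for complete regular local bases of dimension `≤ 4` (printed `≤ 3` + `= 4`)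
  have hAtom : ∀ (S : Type) [CommRing S] [IsRegularLocalRing S] [CharP S p]
      [IsAdicComplete (IsLocalRing.maximalIdeal S) S]
      [PerfectField (IsLocalRing.ResidueField S)], ringKrullDim S ≤ (4 : ℕ) →
      ∀ (T : Scheme.{0}) (f : T ⟶ Spec (.of S)), IsIntegral T → IsProper f → IsBirational f →
        (∀ t : T, f.base t ≠ IsLocalRing.closedPoint S → IsRegularLocalRing (T.presheaf.stalk t)) →
        ∃ (J : T.IdealSheafData) (T' : Scheme.{0}) (π : T' ⟶ T), J ≠ ⊥ ∧
          (∀ t : T, t ∈ J.support → f.base t = IsLocalRing.closedPoint S) ∧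
          IsBlowup π J ∧ Scheme.IsRegular T' :=
    fun S _ _ _ _ _ hdim T fT hT hfT hbir hoff =>
      @punctualCompletePerfect_four_of_printed_of_atomDimFour p hp hG hP hCJS hA4 S _ _ _ _ _
        hdim T fT hT hfT hbir hoff
  -- the roof engine over `k`, fed at non-closed points by the dimension-3 theorems and at closed
  -- points by the algebraized atom
  have hR : ∀ (M : Scheme.{0}) (g : M ⟶ Spec (.of k)) [IsSeparated g] [LocallyOfFiniteType g]
      [QuasiCompact g] [IsIntegral M], topologicalKrullDim M = 4 →
      (∀ m : M, IsClosed ({m} : Set M) →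
        ∃ (N : Scheme.{0}) (gN : N ⟶ Spec (.of k)) (q : M ⟶ N),
          IsSeparated gN ∧ LocallyOfFiniteType gN ∧ QuasiCompact gN ∧ IsIntegral N ∧
          q ≫ gN = g ∧ IsProper q ∧ IsBirational q ∧ topologicalKrullDim N ≤ 4 ∧
          IsRegularLocalRing (N.presheaf.stalk (q.base m))) →
      Scheme.HasResolution M :=
    fun M g _ _ _ _ hdim hroof =>
      stub_roofEngine p hp
        (fun k₂ _ M₂ g₂ _ _ _ _ hdim₂ ζ hζ X' f' J hf' =>
          stub_localDesingNonClosed hG hP k₂ M₂ g₂ hdim₂ ζ hζ X' f' J hf')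
        (fun k₃ _ _ _ S _ _ _ _ hdimS hfin T fT hT hfT hbir hoff =>
          @stub_algebraizeBlowup p hp hAtom k₃ _ _ _ S _ _ _ _ hdimS hfin T fT hT hfT hbir hoff)
        k M g hdim hroof
  -- weak resolution over `k` up to dimension `4`, by reduction to the projective integral case
  have h4 : ResolutionOverUpToDim k 4 :=
    ResolutionOverUpToDim.of_projective fun n Y ι hι hint hY => by
      haveI := hι
      haveI := hint
      exact PatchingRelPerfect.SliceOfEngine.hasResolution_projective_of_dim_le_four hCP hLU' hR
        Y ι hY
  exact h4 X f ‹_› ‹_› ‹_› inferInstance (by exact_mod_cast hX)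

/-- **The crux `AbhyankarShadows.PatchingPerfect` BY NAME, from the printed dimension-`≤ 3`
theorems (Cossart–Piltant 2019 Thm. 1.1 and Prop. 4.4; Cossart–Jannsen–Saito 2020 Thm. 1.2 in
single-blow-up format), the dimension-EXACTLY-4 ATOM (the registered `stub_atomDimFour` of the
sibling crux stmt-16161, verbatim) and the FIBREWISE dimension-`≥ 5` residual** (for each perfect
`k`: relative LU over `k` ⇒ resolution of every integral separated `k`-scheme of finite type of
dimension `≥ 5`). Proof: fix `p`, `k`, LU over `k`, and a reduced separated `X/k` of finite type;
reduce to its integral closed subschemes over the same `k` (`hasResolution_of_forall_closeds`) and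
split on `dim ≤ 4` (`patchingPerfect_hasResolution_dimLeFour_of_printed_of_atomDimFour`) versus
`¬ dim ≤ 4` (the residual). A CONDITIONAL result — the certificate of line `birth` v4; the item
stays open. [cite: Piltant2013, Prop. 5.1, Cor. 5.7 and p. 2] [cite: Temkin2008, Prop. 2.3.4]
[cite: CossartPiltant2019, Thm. 1.1, Prop. 4.4 and proof of Prop. 4.6, Step 1] -/
theorem patchingPerfect_of_printed_of_atomDimFour_of_dimGeFiveAt
    (hG : CossartPiltant2019General.{0}) (hP : CossartPiltant2019Principalization.{0})
    (hCJS : ∀ (X : Scheme.{0}) [IsNoetherian X] [IsReduced X], Scheme.IsExcellent X →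
      topologicalKrullDim X ≤ 2 → Scheme.AdmitsDesingularization X)
    (hA4 : ∀ (p : ℕ), p.Prime → ∀ (S : Type) [CommRing S] [IsRegularLocalRing S] [CharP S p]
      [IsAdicComplete (IsLocalRing.maximalIdeal S) S]
      [PerfectField (IsLocalRing.ResidueField S)], ringKrullDim S = (4 : ℕ) →
      ∀ (T : Scheme.{0}) (f : T ⟶ Spec (.of S)), IsIntegral T → IsProper f → IsBirational f →
        (∀ t : T, f.base t ≠ IsLocalRing.closedPoint S → IsRegularLocalRing (T.presheaf.stalk t)) →
        ∃ (J : T.IdealSheafData) (T' : Scheme.{0}) (π : T' ⟶ T), J ≠ ⊥ ∧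
          (∀ t : T, t ∈ J.support → f.base t = IsLocalRing.closedPoint S) ∧
          IsBlowup π J ∧ Scheme.IsRegular T')
    (h5 : ∀ (p : ℕ), p.Prime → ∀ (k : Type) [Field k] [CharP k p] [PerfectField k],
      (∀ (K : Type) [Field K] [Algebra k K], (⊤ : IntermediateField k K).FG →
        ∀ O : ValuationSubring K, (∀ c : k, algebraMap k K c ∈ O) → ∀ R : Subalgebra k K, R.FG →
          R.toSubring ≤ O.toSubring → ∃ (A : Subalgebra k K) (h : A.toSubring ≤ O.toSubring),
            R ≤ A ∧ A.FG ∧ IsFractionRing A K ∧ IsRegularLocalRing (Localization.AtPrime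
              (Ideal.comap (Subring.inclusion h) (IsLocalRing.maximalIdeal O)))) →
      ∀ (X : Scheme.{0}) (f : X ⟶ Spec (.of k)),
        IsSeparated f → LocallyOfFiniteType f → QuasiCompact f → IsIntegral X →
        ¬ topologicalKrullDim X ≤ 4 → Scheme.HasResolution X) :
    Summit.ResolutionOfSingularities.ResolutionOfSingularities.Theses.AbhyankarShadows.PatchingPerfect := by
  intro p hp k _ _ _ hLU X f hsep hft hqc hred
  refine hasResolution_of_forall_closeds X f fun Z hZ => ?_
  haveI := hZ
  let ι := (Scheme.IdealSheafData.vanishingIdeal Z).subschemeι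
  by_cases hd : topologicalKrullDim ↥(Scheme.IdealSheafData.vanishingIdeal Z).subscheme ≤ 4
  · exact patchingPerfect_hasResolution_dimLeFour_of_printed_of_atomDimFour p hp hG hP hCJS
      (hA4 p hp) k hLU _ (ι ≫ f) hd
  · exact h5 p hp k hLU _ (ι ≫ f) inferInstance inferInstance inferInstance hZ hd

/-- The same certificate for the `IndSmooth` copy of the shared crux (the two route copies are
one term). [folklore] -/
theorem indSmooth_patchingPerfect_of_printed_of_atomDimFour_of_dimGeFiveAt
    (hG : CossartPiltant2019General.{0}) (hP : CossartPiltant2019Principalization.{0})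
    (hCJS : ∀ (X : Scheme.{0}) [IsNoetherian X] [IsReduced X], Scheme.IsExcellent X →
      topologicalKrullDim X ≤ 2 → Scheme.AdmitsDesingularization X)
    (hA4 : ∀ (p : ℕ), p.Prime → ∀ (S : Type) [CommRing S] [IsRegularLocalRing S] [CharP S p]
      [IsAdicComplete (IsLocalRing.maximalIdeal S) S]
      [PerfectField (IsLocalRing.ResidueField S)], ringKrullDim S = (4 : ℕ) →
      ∀ (T : Scheme.{0}) (f : T ⟶ Spec (.of S)), IsIntegral T → IsProper f → IsBirational f →
        (∀ t : T, f.base t ≠ IsLocalRing.closedPoint S → IsRegularLocalRing (T.presheaf.stalk t)) →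
        ∃ (J : T.IdealSheafData) (T' : Scheme.{0}) (π : T' ⟶ T), J ≠ ⊥ ∧
          (∀ t : T, t ∈ J.support → f.base t = IsLocalRing.closedPoint S) ∧
          IsBlowup π J ∧ Scheme.IsRegular T')
    (h5 : ∀ (p : ℕ), p.Prime → ∀ (k : Type) [Field k] [CharP k p] [PerfectField k],
      (∀ (K : Type) [Field K] [Algebra k K], (⊤ : IntermediateField k K).FG →
        ∀ O : ValuationSubring K, (∀ c : k, algebraMap k K c ∈ O) → ∀ R : Subalgebra k K, R.FG →
          R.toSubring ≤ O.toSubring → ∃ (A : Subalgebra k K) (h : A.toSubring ≤ O.toSubring),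
            R ≤ A ∧ A.FG ∧ IsFractionRing A K ∧ IsRegularLocalRing (Localization.AtPrime
              (Ideal.comap (Subring.inclusion h) (IsLocalRing.maximalIdeal O)))) →
      ∀ (X : Scheme.{0}) (f : X ⟶ Spec (.of k)),
        IsSeparated f → LocallyOfFiniteType f → QuasiCompact f → IsIntegral X →
        ¬ topologicalKrullDim X ≤ 4 → Scheme.HasResolution X) :
    Summit.ResolutionOfSingularities.ResolutionOfSingularities.Theses.IndSmooth.PatchingPerfect :=
  patchingPerfect_of_printed_of_atomDimFour_of_dimGeFiveAt hG hP hCJS hA4 h5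

/-- **The fibrewise crux implies the uniform sibling crux**: `AbhyankarShadows.PatchingPerfect`
(for each perfect `k`: LU over `k` ⇒ resolution over `k`) implies
`FrobeniusClosing.PatchingRelPerfect` (LU over all perfect fields of characteristic `p` ⇒
resolution over all of them; stmt-ResolutionOfSingularities-16161) — instantiate the uniform
antecedent at the ground field. So a proof of stmt-16089 closes stmt-16161. [folklore] -/
theorem patchingRelPerfect_of_patchingPerfect
    (h : Summit.ResolutionOfSingularities.ResolutionOfSingularities.Theses.AbhyankarShadows.PatchingPerfect) :
    Summit.ResolutionOfSingularities.ResolutionOfSingularities.Theses.FrobeniusClosing.PatchingRelPerfect :=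
  fun p hp hLU k _ _ _ X f hsep hft hqc hred =>
    h p hp k (fun K _ _ => hLU k K) X f hsep hft hqc hred

end Summit.ResolutionOfSingularities.ResolutionOfSingularities.Theorems

end
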